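import Summits.QuantumFields.YangMills.Theorems.ParabolicTrajectoryContinuumLimitOnTrajectoryStubArpA
import Summits.QuantumFields.YangMills.Theorems.ParabolicTrajectoryLatticeGapOnTrajectoryTransferFromOSGapLattice

/-!
# Stub `stub_arp : ARPOfRP` (line `two-orbit-synchronisation`, crux stmt-QuantumFields-10522), part B:
# reflection, measurability, slab support of the lattice functional; the positive-time observable and its OS pairing

Second helper file of the stub worker for `stub_arp` (seat c2); continues `…StubArpA` (`Arp.lat sch k W F`). Everything in
the sub-namespace `Arp`.
* `lat_negReflect` — EXACT REFLECTION: `(lat W F)(Θ'U) = (lat (W ∘ Θ₀) (θF))(U)` (`Θ' = GaugeConfig.negReflect`,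
  `Θ₀ = cfgReflect`; the box is `θ₀`-symmetric, `torusLift_negReflect`, `cfgReflect_configShift`);
* `measurable_lat`, `exists_bound_lat` — bounded measurable for bounded measurable strings; `dependsOn_lat` — SLAB SUPPORT:
  against a test function supported in the time slab `[lo, hi]` the lattice functional of a species string depends only on the
  links based at lattice times `1, …, w` (`a(R+1) ≤ lo`, `hi + aR ≤ a w`, `R` the time radius) — the format of `TorusSlabRP`;
* `obsA` — the positive-time observable `A = ∑ⱼ lat P̃ F'ⱼ` of a finite family of test functions (`P̃` the centred corner
  density), bounded measurable; `conj_obsA_negReflect` — `conj (A(Θ'U)) = ∑ⱼ lat (P̃∘Θ₀) F̃ⱼ (U)`, `F̃ = conj θF` (`Ftil`);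
* `osPairing_obsA_nonneg` — `∫ conj(A∘Θ') · A dμ_k` is real `≥ 0` whenever slab reflection positivity holds at step `k` and the
  `F'ⱼ` are supported in a time slab `[δⱼ, T₀]` with `a_k (R+1) ≤ δⱼ`, `T₀ + a_k R ≤ a_k w`, `2w ≤ L_k`.
-/

set_option autoImplicit false

open scoped SchwartzMap ComplexConjugate
open MeasureTheory Filter Topology
open Literature.MathematicalPhysics.QuantumFieldTheory Literature.MathematicalPhysics.QuantumLattice
open Literature.MathematicalPhysics.AQFT Literature.Probability.LatticeModels
open Summit.QuantumFields.YangMills.Theses.ParabolicTrajectory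

noncomputable section

namespace Summit.QuantumFields.YangMills.Cruxes.ContinuumLimitOnTrajectory.TwoOrbitSynchronisation

local notation "𝔼" => EuclideanSpace ℝ (Fin 4)

/-- (disambiguation: the gauge-configuration translation of `QuantumLattice`, not the spin one of `LatticeModels`) -/
local notation "cfgShift" => Literature.MathematicalPhysics.QuantumLattice.configShift

/-- (the time radius of a species, from the transfer files of crux (B); a notation to keep clear of the Literature
namesake) -/
local notation "tRadius" =>
  Summit.QuantumFields.YangMills.Cruxes.LatticeGapOnTrajectory.OrbitKantorovichFiniteSize.Transfer.timeRadius

namespace Arp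

section LatB

variable {G : Type} [Group G] [MeasurableSpace G]

/-! ## §B.1 Exact reflection -/

/-- The site time reflection of the box `{−L,…,L}⁴` as a permutation. -/
def boxReflectPerm (L : ℕ) : Equiv.Perm ↥(box 4 L) :=
  Function.Involutive.toPerm boxSiteReflect boxSiteReflect_boxSiteReflect

/-- `boxReflectPerm` is `boxSiteReflect`. -/
@[simp] theorem boxReflectPerm_apply (L : ℕ) (x : ↥(box 4 L)) : boxReflectPerm L x = boxSiteReflect x := rfl

/-- **Exact reflection of the lattice functional**: reading `lat W F` on the reflected torus configuration is the
lattice functional of the reflected observables `Wᵢ ∘ Θ₀` against the reflected test function `θF`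
(reindex the box strings by `θ₀`; `τ_{θ₀x} ∘ Θ₀ = Θ₀ ∘ τ_x`; `θ(a x) = a θ₀x`). -/
theorem lat_negReflect (sch : SpeciesScheme (YMSpecies G)) (k : ℕ) {p : ℕ} (W : Fin p → LGConfig 4 G → ℝ)
    (F : 𝓢((Fin p → 𝔼), ℂ)) (U : GaugeConfig 4 (sch.side k) G) :
    lat sch k W F U.negReflect = lat sch k (fun i V => W i (cfgReflect V)) (thetaMulti 4 F) U := by
  unfold lat
  rw [torusLift_negReflect]
  refine Fintype.sum_equiv (Equiv.arrowCongr (Equiv.refl (Fin p)) (boxReflectPerm (sch.L k))) _ _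
    fun x => ?_
  have hx : ∀ i, (((Equiv.arrowCongr (Equiv.refl (Fin p)) (boxReflectPerm (sch.L k))) x i : ↥(box 4 (sch.L k))) :
      Site 4) = siteReflect (↑(x i) : Site 4) := fun i => rfl
  simp only [hx, thetaMulti_apply, timeReflection_smul_siteToE, siteReflect_siteReflect,
    cfgReflect_configShift, siteReflect_neg]

/-! ## §B.3 Measurability, boundedness, slab support -/

/-- The lattice functional of a string of measurable observables is measurable in the torus configuration. -/
theorem measurable_lat (sch : SpeciesScheme (YMSpecies G)) (k : ℕ) {p : ℕ} {W : Fin p → LGConfig 4 G → ℝ}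
    (hW : ∀ i, Measurable (W i)) (F : 𝓢((Fin p → 𝔼), ℂ)) : Measurable (lat sch k W F) := by
  unfold lat
  refine Finset.measurable_sum _ fun x _ => measurable_const.mul (Finset.measurable_prod _ fun i _ => ?_)
  exact Complex.measurable_ofReal.comp ((hW i).comp ((cfgShift _).measurable.comp (measurable_torusLift _)))

/-- The lattice functional of a string of bounded observables is bounded. -/
theorem exists_bound_lat (sch : SpeciesScheme (YMSpecies G)) (k : ℕ) {p : ℕ} {W : Fin p → LGConfig 4 G → ℝ}
    (hW : ∀ i, ∃ C, ∀ V, |W i V| ≤ C) (F : 𝓢((Fin p → 𝔼), ℂ)) : ∃ B, ∀ U, ‖lat sch k W F U‖ ≤ B := by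
  choose C hC using hW
  refine ⟨∑ x : Fin p → ↥(box 4 (sch.L k)), ‖F (fun i => sch.a k • siteToE (↑(x i) : Site 4))‖ * ∏ i, |C i|,
    fun U => (norm_sum_le _ _).trans (Finset.sum_le_sum fun x _ => ?_)⟩
  rw [norm_mul, norm_prod]
  refine mul_le_mul_of_nonneg_left (Finset.prod_le_prod (fun i _ => norm_nonneg _) fun i _ => ?_) (norm_nonneg _)
  rw [Complex.norm_real, Real.norm_eq_abs]
  exact (hC i _).trans (le_abs_self _)

/-- **Slab support.** Against a test function vanishing unless every time coordinate lies in `[lo, hi]`, the lattice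
functional of a (shifted-by-constants) species string depends only on the torus links based at lattice times
`1, …, w`, as soon as `a (Rᵢ + 1) ≤ lo` and `hi + a Rᵢ ≤ a w < a · side` (`Rᵢ` the time radius of `σᵢ`). -/
theorem dependsOn_lat (sch : SpeciesScheme (YMSpecies G)) (k : ℕ) {p : ℕ} (σ : Fin p → YMSpecies G)
    (c : Fin p → ℝ) (F : 𝓢((Fin p → 𝔼), ℂ)) {lo hi : ℝ} (hF : ∀ x, F x ≠ 0 → ∀ i, lo ≤ x i 0 ∧ x i 0 ≤ hi)
    {w : ℕ} (hlo : ∀ i, sch.a k * (tRadius (σ i) + 1) ≤ lo)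
    (hhi : ∀ i, hi + sch.a k * tRadius (σ i) ≤ sch.a k * w) (hw : w < sch.side k) :
    DependsOn (lat sch k (fun i V => (σ i).F V - c i) F)
      {e : Edge 4 (sch.side k) | 1 ≤ (e.1 0).val ∧ (e.1 0).val ≤ w} := by
  intro U V hUV
  unfold lat
  refine Finset.sum_congr rfl fun x _ => ?_
  by_cases hx : F (fun i => sch.a k • siteToE (↑(x i) : Site 4)) = 0
  · simp [hx]
  congr 1
  refine Finset.prod_congr rfl fun i _ => ?_
  have ha : 0 < sch.a k := sch.a_pos k
  have hx' := hF _ hx i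
  simp only [PiLp.smul_apply, siteToE_apply, smul_eq_mul] at hx'
  set y : Site 4 := ↑(x i) with hy
  have h1 : (tRadius (σ i) : ℝ) + 1 ≤ (y 0 : ℝ) := le_of_mul_le_mul_left ((hlo i).trans hx'.1) ha
  have h2 : (y 0 : ℝ) + tRadius (σ i) ≤ w := by
    refine le_of_mul_le_mul_left ?_ ha
    nlinarith [hx'.2, hhi i]
  have h1' : (tRadius (σ i) : ℤ) + 1 ≤ y 0 := by exact_mod_cast h1
  have h2' : y 0 + (tRadius (σ i) : ℤ) ≤ w := by exact_mod_cast h2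
  have hO : (σ i).F (cfgShift (-y) (torusLift (sch.side k) U)) =
      (σ i).F (cfgShift (-y) (torusLift (sch.side k) V)) := by
    refine (σ i).isCylinder fun e he => ?_
    simp only [Literature.MathematicalPhysics.QuantumLattice.configShift_apply, torusLift, Function.comp_apply]
    refine hUV _ ?_
    have hR := abs_le.1
      (Summit.QuantumFields.YangMills.Cruxes.LatticeGapOnTrajectory.OrbitKantorovichFiniteSize.Transfer.abs_le_timeRadius
        (σ i) he)
    have hz : (1 : ℤ) ≤ (e.1 - -y) 0 ∧ (e.1 - -y) 0 ≤ w := by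
      simp only [Pi.sub_apply, Pi.neg_apply]
      constructor <;> omega
    have hw' : (w : ℤ) < sch.side k := by exact_mod_cast hw
    have hval : ((((e.1 - -y) 0 : ℤ) : ZMod (sch.side k)).val : ℤ) = (e.1 - -y) 0 := by
      rw [ZMod.val_intCast, Int.emod_eq_of_lt (by omega) (by omega)]
    simp only [Set.mem_setOf_eq, torusEdge, Torus.proj_apply]
    constructor <;> omega
  show (((σ i).F (cfgShift (-y) (torusLift (sch.side k) U)) - c i : ℝ) : ℂ) =
    (((σ i).F (cfgShift (-y) (torusLift (sch.side k) V)) - c i : ℝ) : ℂ)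
  rw [hO]

end LatB

/-! ## §B.4 The positive-time observable of a truncated family and its OS pairing -/

section ObsA

variable {G : Type} [Group G] [TopologicalSpace G] [IsTopologicalGroup G] [CompactSpace G]
  [MeasurableSpace G] [BorelSpace G]

/-- The conjugated reflected test function `conj F(θ·)` (`= (ΘF*)` with its arguments reversed). -/
abbrev Ftil {p : ℕ} (F : 𝓢((Fin p → 𝔼), ℂ)) : 𝓢((Fin p → 𝔼), ℂ) := starTest (thetaMulti 4 F)

/-- **The positive-time observable** `A = ∑ⱼ lat P̃ F'ⱼ` of a finite family of test functions. -/
def obsA (r : LatticeRep G) (sch : SpeciesScheme (YMSpecies G)) (k : ℕ) {N : ℕ} (deg : Fin N → ℕ)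
    (F' : (j : Fin N) → 𝓢((Fin (deg j) → 𝔼), ℂ)) (U : GaugeConfig 4 (sch.side k) G) : ℂ :=
  ∑ j, lat sch k (fun _ => cen r sch k r.curvature.F) (F' j) U

/-- Bounded measurable complex observables are integrable for the torus Wilson measure. -/
theorem integrable_of_bdd (r : LatticeRep G) (sch : SpeciesScheme (YMSpecies G)) (k : ℕ)
    {X : GaugeConfig 4 (sch.side k) G → ℂ} (hX : Measurable X) (hb : ∃ C, ∀ U, ‖X U‖ ≤ C) :
    Integrable X (μW r sch k) := by
  obtain ⟨C, hC⟩ := hb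
  exact Integrable.of_bound hX.aestronglyMeasurable C (Eventually.of_forall hC)

omit [Group G] [TopologicalSpace G] [IsTopologicalGroup G] [CompactSpace G] [BorelSpace G] in
/-- Products of bounded measurable observables are bounded measurable. -/
theorem measurable_bdd_mul {S : ℕ} {X Y : GaugeConfig 4 S G → ℂ} (hX : Measurable X ∧ ∃ C, ∀ U, ‖X U‖ ≤ C)
    (hY : Measurable Y ∧ ∃ C, ∀ U, ‖Y U‖ ≤ C) :
    Measurable (fun U => X U * Y U) ∧ ∃ C, ∀ U, ‖X U * Y U‖ ≤ C := by
  obtain ⟨hXm, C, hC⟩ := hX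
  obtain ⟨hYm, D, hD⟩ := hY
  refine ⟨hXm.mul hYm, C * D, fun U => ?_⟩
  rw [norm_mul]
  exact mul_le_mul (hC U) (hD U) (norm_nonneg _) ((norm_nonneg _).trans (hC U))

omit [Group G] [TopologicalSpace G] [IsTopologicalGroup G] [CompactSpace G] [BorelSpace G] in
/-- Differences of bounded measurable observables are bounded measurable. -/
theorem measurable_bdd_sub {S : ℕ} {X Y : GaugeConfig 4 S G → ℂ} (hX : Measurable X ∧ ∃ C, ∀ U, ‖X U‖ ≤ C)
    (hY : Measurable Y ∧ ∃ C, ∀ U, ‖Y U‖ ≤ C) :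
    Measurable (fun U => X U - Y U) ∧ ∃ C, ∀ U, ‖X U - Y U‖ ≤ C := by
  obtain ⟨hXm, C, hC⟩ := hX
  obtain ⟨hYm, D, hD⟩ := hY
  exact ⟨hXm.sub hYm, C + D, fun U => (norm_sub_le _ _).trans (add_le_add (hC U) (hD U))⟩

omit [Group G] [TopologicalSpace G] [IsTopologicalGroup G] [CompactSpace G] [BorelSpace G] in
/-- Finite sums of bounded measurable observables are bounded measurable. -/
theorem measurable_bdd_sum {S : ℕ} {ι : Type} [Fintype ι] {X : ι → GaugeConfig 4 S G → ℂ}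
    (hX : ∀ i, Measurable (X i) ∧ ∃ C, ∀ U, ‖X i U‖ ≤ C) :
    Measurable (fun U => ∑ i, X i U) ∧ ∃ C, ∀ U, ‖∑ i, X i U‖ ≤ C := by
  choose hm C hC using hX
  exact ⟨Finset.measurable_sum _ fun i _ => hm i, ∑ i, C i, fun U =>
    (norm_sum_le _ _).trans (Finset.sum_le_sum fun i _ => hC i U)⟩

/-- The curvature lattice functional is bounded measurable. -/
theorem measurable_bdd_latP (r : LatticeRep G) (sch : SpeciesScheme (YMSpecies G)) (k : ℕ) {p : ℕ}
    (F : 𝓢((Fin p → 𝔼), ℂ)) :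
    Measurable (lat sch k (fun _ => cen r sch k r.curvature.F) F) ∧
      ∃ C, ∀ U, ‖lat sch k (fun _ => cen r sch k r.curvature.F) F U‖ ≤ C := by
  refine ⟨measurable_lat sch k (fun _ => r.curvature.measurable.sub measurable_const) F,
    exists_bound_lat sch k (fun _ => ?_) F⟩
  obtain ⟨C, hC⟩ := r.curvature.bounded
  exact ⟨C + |wilsonTorusMean r.ρ (sch.β k) (sch.L k) r.curvature.F|, fun V =>
    (abs_sub _ _).trans (add_le_add (hC V) le_rfl)⟩

/-- The reflected-curvature lattice functional is bounded measurable. -/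
theorem measurable_bdd_latP_refl (r : LatticeRep G) (sch : SpeciesScheme (YMSpecies G)) (k : ℕ) {p : ℕ}
    (F : 𝓢((Fin p → 𝔼), ℂ)) :
    Measurable (lat sch k (fun _ V => cen r sch k r.curvature.F (cfgReflect V)) F) ∧
      ∃ C, ∀ U, ‖lat sch k (fun _ V => cen r sch k r.curvature.F (cfgReflect V)) F U‖ ≤ C := by
  refine ⟨measurable_lat sch k (fun _ => (r.curvature.measurable.comp measurable_cfgReflect).sub
    measurable_const) F, exists_bound_lat sch k (fun _ => ?_) F⟩
  obtain ⟨C, hC⟩ := r.curvature.bounded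
  exact ⟨C + |wilsonTorusMean r.ρ (sch.β k) (sch.L k) r.curvature.F|, fun V =>
    (abs_sub _ _).trans (add_le_add (hC _) le_rfl)⟩

/-- `obsA` is bounded measurable. -/
theorem measurable_bdd_obsA (r : LatticeRep G) (sch : SpeciesScheme (YMSpecies G)) (k : ℕ) {N : ℕ}
    (deg : Fin N → ℕ) (F' : (j : Fin N) → 𝓢((Fin (deg j) → 𝔼), ℂ)) :
    Measurable (obsA r sch k deg F') ∧ ∃ C, ∀ U, ‖obsA r sch k deg F' U‖ ≤ C :=
  measurable_bdd_sum fun j => measurable_bdd_latP r sch k (F' j)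

/-- Appending two constant strings gives the constant string. -/
theorem append_const {α : Type} {n m : ℕ} (c : α) : Fin.append (fun _ : Fin n => c) (fun _ : Fin m => c) = fun _ => c := by
  funext i
  refine Fin.addCases (fun j => ?_) (fun j => ?_) i
  · simp only [Fin.append_left]
  · simp only [Fin.append_right]

/-- The conjugated reflected positive-time observable is the reflected-curvature observable of the `F̃ⱼ`:
`conj (A(Θ'U)) = ∑ⱼ lat (P̃∘Θ₀) F̃ⱼ (U)`. -/
theorem conj_obsA_negReflect (r : LatticeRep G) (sch : SpeciesScheme (YMSpecies G)) (k : ℕ) {N : ℕ}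
    (deg : Fin N → ℕ) (F' : (j : Fin N) → 𝓢((Fin (deg j) → 𝔼), ℂ)) (U : GaugeConfig 4 (sch.side k) G) :
    conj (obsA r sch k deg F' U.negReflect) =
      ∑ j, lat sch k (fun _ V => cen r sch k r.curvature.F (cfgReflect V)) (Ftil (F' j)) U := by
  simp only [obsA, map_sum, lat_negReflect, conj_lat]

/-- A support bound on the time coordinates passes to the conjugated reflected test function. -/
theorem Ftil_support_bound {p : ℕ} {F : 𝓢((Fin p → 𝔼), ℂ)} {T : ℝ} (hF : ∀ x, F x ≠ 0 → ∀ l, |x l 0| ≤ T)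
    (x : Fin p → 𝔼) (hx : Ftil F x ≠ 0) (l : Fin p) : |x l 0| ≤ T := by
  have hx' : F (fun i => timeReflection 4 (x i)) ≠ 0 := by
    simpa [Ftil, starTest_apply, thetaMulti_apply] using hx
  have h := hF _ hx' l
  simpa [timeReflection_apply] using h

/-! ## §D.3 Positivity of the OS pairing of the slab observable -/

omit [Group G] [TopologicalSpace G] [IsTopologicalGroup G] [CompactSpace G] [MeasurableSpace G] [BorelSpace G] in
/-- Finite sums preserve `DependsOn`. -/
theorem dependsOn_finset_sum {S : ℕ} {ι : Type} [Fintype ι] {X : ι → GaugeConfig 4 S G → ℂ}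
    {E : Set (Edge 4 S)} (h : ∀ i, DependsOn (X i) E) : DependsOn (fun U => ∑ i, X i U) E :=
  fun _ _ hUV => Finset.sum_congr rfl fun i _ => h i hUV

/-- **`∫ conj(A∘Θ') A dμ_k` is real non-negative** as soon as slab reflection positivity holds at step `k` (the
hypothesis of `TorusSlabRP` at `k`), the test functions are supported in the time slab `[δ, T₀]` with
`a_k (R + 1) ≤ δ`, `T₀ + a_k R ≤ a_k w`, `2w ≤ L_k` (`R` the time radius of the curvature species). -/
theorem osPairing_obsA_nonneg (r : LatticeRep G) (sch : SpeciesScheme (YMSpecies G)) (k : ℕ)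
    (hRP : ∀ (w : ℕ) (X : GaugeConfig 4 (sch.side k) G → ℂ), Measurable X → (∃ B, ∀ U, ‖X U‖ ≤ B) →
      DependsOn X {e : Edge 4 (sch.side k) | 1 ≤ (e.1 0).val ∧ (e.1 0).val ≤ w} → 2 * w ≤ sch.L k →
        0 ≤ (∫ U, conj (X U.negReflect) * X U ∂(wilsonMeasure r.ρ (sch.β k))).re ∧
          (∫ U, conj (X U.negReflect) * X U ∂(wilsonMeasure r.ρ (sch.β k))).im = 0)
    {N : ℕ} (deg : Fin N → ℕ) (F' : (j : Fin N) → 𝓢((Fin (deg j) → 𝔼), ℂ)) {δ : Fin N → ℝ} {T₀ : ℝ}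
    (hF' : ∀ j x, F' j x ≠ 0 → ∀ l, δ j ≤ x l 0 ∧ x l 0 ≤ T₀) {w : ℕ}
    (hlo : ∀ j, sch.a k * (tRadius r.curvature + 1) ≤ δ j)
    (hhi : T₀ + sch.a k * tRadius r.curvature ≤ sch.a k * w) (hw : 2 * w ≤ sch.L k) :
    0 ≤ (∫ U, conj (obsA r sch k deg F' U.negReflect) * obsA r sch k deg F' U ∂(μW r sch k)).re ∧
      (∫ U, conj (obsA r sch k deg F' U.negReflect) * obsA r sch k deg F' U ∂(μW r sch k)).im = 0 := by
  obtain ⟨hm, hb⟩ := measurable_bdd_obsA r sch k deg F'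
  refine hRP w _ hm hb (dependsOn_finset_sum fun j => ?_) hw
  have hws : w < sch.side k := by change w < 2 * sch.L k + 1; omega
  exact dependsOn_lat sch k (fun _ => r.curvature) (fun _ => wilsonTorusMean r.ρ (sch.β k) (sch.L k) r.curvature.F)
    (F' j) (hF' j) (fun _ => hlo j) (fun _ => hhi) hws

end ObsA

end Arp

/-- **Registered anchor of this file** (closed form of `Arp.lat_negReflect`, for the gate's `--supports` stub check):
exact reflection of the lattice functional. -/
theorem arpB_lat_negReflect :
    ∀ {G : Type} [Group G] [MeasurableSpace G] (sch : SpeciesScheme (YMSpecies G)) (k p : ℕ)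
      (W : Fin p → LGConfig 4 G → ℝ) (F : 𝓢((Fin p → EuclideanSpace ℝ (Fin 4)), ℂ)) (U : GaugeConfig 4 (sch.side k) G),
      Arp.lat sch k W F U.negReflect = Arp.lat sch k (fun i V => W i (cfgReflect V)) (thetaMulti 4 F) U := by
  intro G _ _ sch k p W F U
  exact Arp.lat_negReflect sch k W F U

end Summit.QuantumFields.YangMills.Cruxes.ContinuumLimitOnTrajectory.TwoOrbitSynchronisation

end
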